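import Literature.AlgebraicGeometry.Milne1999.LefschetzCentraliser
import Literature.AlgebraicGeometry.HodgeTheory.HodgeClassesIsogenyInvariance
import Literature.AlgebraicGeometry.Motives.AbelianVarietyIsogenyProofs
import HarnessLib

/-!
# Milne's `C(A)`, `S(A)`, `G(A)` depend only on the isogeny class of `A` (Milne 1999, Duke 96, §1 pp. 643–644), read on `H¹`

Family `hodge`, layer `Literature/AlgebraicGeometry/Milne1999`, namespace
`Literature.AlgebraicGeometry.Milne1999` (D-0022). Theorems-and-constructions sequel of
`Milne1999/LefschetzCentraliser` (`centralizerAlgebra A = C(A) ⊗ ℂ`, `centralizerGroup A = (C(A) ⊗ ℂ)^×`,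
`unitaryCentralizerGroup A h = S(A)(ℂ)`, `similitudeCentralizerGroup A h = G(A)(ℂ)`, all read on
`H¹(A(ℂ); ℂ)`) and of `Milne1999/LefschetzCentraliserProducts`, which lists "the transport along an isogeny"
under "What is NOT here". Written for the cell `pub-hodgecm2` (COR-CM, Hodge ladder stage 2), literature
fan-out plan `HOME/lit/LIT-FANOUT-PLAN.md` row INFRA-04-1 (Milne 1999a §§1–2, 4), PROVED (D-0026: no named
fact is introduced; the `def`s below are linear-algebra constructions with bodies; net debt 0).

## Source read (held text `paper:doi-10-1215-s0012-7094-99-09620-5` = J. S. Milne, *Lefschetz classes on abelian varieties*, Duke Math. J. 96 (1999) 639–675, author version 1999aP), verbatim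

* §1, p. 643 [corpus: paper:doi-10-1215-s0012-7094-99-09620-5 p0005 L7–L11]: "An isogeny `α : A → B`
  defines an isomorphism `γ ↦ V(α) ∘ γ ∘ V(α)⁻¹ : C(A) → C(B)` of `k`-algebras with involution, which is
  independent of the choice of `α`. Therefore `C(A)`, as a `k`-algebra with involution, depends only on
  the isogeny class of `A` (up to a canonical isomorphism)."
* §1, p. 644 [ibid. p0006 L19–L20]: "Clearly `S(A)` depends only on the isogeny class of `A` (up to a
  unique isomorphism)."
* Notations, p. 641 [ibid. p0003 L33–L34]: "By an "isogeny `A → B`" we mean an element of `Hom⁰(A, B)`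
  that admits an inverse in `Hom⁰(B, A)`."
* D. Mumford, *Abelian Varieties* (1970), §19, Remark p. 169: an isogeny `f : A → B` has a quasi-inverse
  `g : B → A` with `g ∘ f = [n]_A`, `f ∘ g = [n]_B` (`n = deg f`) — the tree's THEOREM
  `AbelianVariety.IsIsogeny.exists_nsmul_inverse_holds`; and `[n]^* = n` on `H¹` (the tree's
  `complexBetti_map_nsmul_id_apply`). So a genuine isogeny `f` is an isogeny in Milne's sense, with
  inverse `n⁻¹ g ∈ Hom⁰(B, A)`, and `V(α)⁻¹` is `n⁻¹ V(g)`.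

## Lean rendering (the tree's carriers; `ℂ`-points; everything read on `H¹`)

As in `Milne1999/LefschetzCentraliser`: `H¹(A(ℂ); ℂ) = complexBetti A.X 1 = V(A)^∨ ⊗ ℂ`, `End(A)` acts by the
pull-backs `φ^* = VanGeemen1994.pullbackOne A φ`, and Milne's `γ ∈ GL(V(A))` is read as `u = (γ^∨)⁻¹ ∈ GL(H¹)`.
For an isogeny `f : A ⟶ B` (the tree's `AbelianVariety.IsIsogeny f`: surjective and finite) the pull-back
`f^* : H¹(B(ℂ); ℂ) → H¹(A(ℂ); ℂ)` is bijective (`complexBetti_map_bijective_of_isIsogeny`, van Geemen §3.6),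
and Milne's `γ ↦ V(α) ∘ γ ∘ V(α)⁻¹` becomes, through `γ ↦ (γ^∨)⁻¹` (which turns `V(α) ∘ – ∘ V(α)⁻¹` into
`(α^*)⁻¹ ∘ – ∘ α^*` from `GL(H¹(A))` to `GL(H¹(B))`, whose inverse is `α^* ∘ – ∘ (α^*)⁻¹`):

* `isogenyPullbackOne hf : H¹(B(ℂ); ℂ) ≃ₗ[ℂ] H¹(A(ℂ); ℂ)` — `f^*` as a linear equivalence; its inverse is
  `n⁻¹ · g^*` (`isogenyPullbackOne_symm_apply`).
* `autConj e : (M ≃ₗ M) ≃* (N ≃ₗ N)`, `u ↦ e ∘ u ∘ e⁻¹` — transport of automorphism groups along a linear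
  equivalence (the group-level companion of Mathlib's `LinearEquiv.conjAlgEquiv` on `End`, `coe_autConj`);
  `isogenyConj hf := autConj (isogenyPullbackOne hf) : GL(H¹(B(ℂ); ℂ)) ≃* GL(H¹(A(ℂ); ℂ))`,
  `u ↦ f^* ∘ u ∘ (f^*)⁻¹`, characterised by `isogenyConj hf u (f^* y) = f^* (u y)` (`isogenyConj_apply_map`).

PROVED (no hypotheses beyond `IsIsogeny f`):
* **`C(B) ⊗ ℂ ≅ C(A) ⊗ ℂ`**: `T ↦ f^* ∘ T ∘ (f^*)⁻¹` maps `centralizerAlgebra B` ONTO `centralizerAlgebra A`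
  (`conjAlgEquiv_mem_centralizerAlgebra_iff`, `centralizerAlgebra_map_conjAlgEquiv`; packaged
  `centralizerAlgebra.isogenyAlgEquiv hf : centralizerAlgebra B ≃ₐ[ℂ] centralizerAlgebra A`). Mechanism (Milne's
  "independent of the choice", run with the quasi-inverse `g`): `f^* ∘ (g ≫ ψ ≫ f)^* = n · ψ^* ∘ f^*` for
  `ψ ∈ End(A)` and `(f ≫ φ ≫ g)^* ∘ f^* = n · f^* ∘ φ^*` for `φ ∈ End(B)` (`map_one_map_conjHom`,
  `map_conjHom'_map_one`), so commuting with `End(B)^*` on `H¹(B)` is commuting with `End(A)^*` on `H¹(A)`.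
* **`(C(B) ⊗ ℂ)^× ≅ (C(A) ⊗ ℂ)^×`, `S(B)(ℂ) ≅ S(A)(ℂ)`, `G(B)(ℂ) ≅ G(A)(ℂ)`**: `isogenyConj hf` maps
  `centralizerGroup B` onto `centralizerGroup A`, `unitaryCentralizerGroup B h` onto
  `unitaryCentralizerGroup A (f^* h)` and `similitudeCentralizerGroup B h` onto
  `similitudeCentralizerGroup A (f^* h)` (same multiplier), for every class `h ∈ H²(B(ℂ); ℂ)`
  (`isogenyConj_mem_centralizerGroup_iff`, `isogenyConj_mem_unitaryCentralizerGroup_iff`,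
  `isogenyConj_mem_similitudeCentralizerGroup_iff`; packaged `centralizerGroup.isogenyMulEquiv`,
  `unitaryCentralizerGroup.isogenyMulEquiv`, `similitudeCentralizerGroup.isogenyMulEquiv`). The polarization
  pairing is transported by the naturality `f^* Q_{h,j}(x, y) = Q_{f^* h, j}(f^* x, f^* y)`
  (`Motives.map_polarizationPairingOne`), the injectivity of `f^*` on `H^{2+2j}`, and `dim A = dim B`
  (`AbelianVariety.dim_eq_of_isIsogeny`).
* **"independent of the choice of `α`"**: two isogenies `f, f' : A ⟶ B` induce the SAME map on `C(B) ⊗ ℂ`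
  (`conjAlgEquiv_eq_of_mem_centralizerAlgebra`, `isogenyConj_eq_of_mem_centralizerGroup`): `(f'^*)⁻¹ ∘ f^* =
  n'⁻¹ (g' ≫ f)^*` is the pull-back of an element of `End⁰(B)`, with which `C(B)` commutes.
* **"up to a unique isomorphism"**, concretely: transporting along `f` and then along a quasi-inverse `g` is the
  identity on ALL of `GL(H¹(B(ℂ); ℂ))` (`isogenyConj_isogenyConj_of_comp_eq_nsmul`: conjugation by `[n]^* = n`
  is trivial); `isogenyConj` is functorial in the isogeny (`isogenyConj_comp`).
* Packaging along `AbelianVariety.IsIsogenous`: `nonempty_centralizerGroup_mulEquiv_of_isIsogenous`,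
  `exists_nonempty_unitaryCentralizerGroup_mulEquiv_of_isIsogenous`, `…similitude…`.

Junk analysis: `autConj`, `isogenyPullbackOne`, `isogenyConj` are total constructions (the latter two take the
proof `hf : IsIsogeny f` as an argument and have no junk branch); the polarization class on `A` is the honest
pull-back `f^* h` of the class on `B` (for `h = cl(D)`, `f^* h = cl(f^* D)`, and `f^* D` is ample when `D` is,
`f` being finite — not formalised and not needed: the statements hold for every `h`).

## Identification with the printed statement (what a reviewer must accept; not formalised)

(1) As in `Milne1999/LefschetzCentraliser` ("Identification" (1)–(2)): `C(A) ⊗ ℂ`, `S(A)(ℂ)`, `G(A)(ℂ)` are read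
on `H¹ = V^∨ ⊗ ℂ` through `γ ↦ (γ^∨)⁻¹`, `e_D ↦ Q_h`. (2) Under this dictionary Milne's
`γ ↦ V(α) ∘ γ ∘ V(α)⁻¹ : C(A) → C(B)` is `u ↦ (α^*)⁻¹ ∘ u ∘ α^*`, `GL(H¹(A)) → GL(H¹(B))`, i.e. the INVERSE
of `isogenyConj`; everything is stated in the direction `H¹(B) → H¹(A)` natural for cohomology (both are
isomorphisms, `MulEquiv.symm`). (3) "of `k`-algebras with involution": the involution `†` (adjoint for
`e_D`) is not a tree object; its only use in the definitions of `S` and `G` — "`γ†γ = 1`", "`γ†γ ∈ R^×`" — is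
rendered by the preservation of `Q_h` (resp. up to a unit), and THAT is what is transported here, class for
class (`h ↦ f^* h`) and multiplier for multiplier. (4) Only `ℂ`-points occur (the tree's convention).

## What is NOT here

* The involution `†` itself and the compatibility "of `k`-algebras with involution" beyond (3); the transport
  of a polarization CLASS to a polarization class (`f^* D` ample) — the group statements do not need it.
* Prop. 1.1 / 1.5 / Cor. 4.7 for `s > 2` factors or powers `A^r` (`Milne1999/LefschetzCentraliserProducts`
  treats `A × B`); Thm. 4.4 (the cited record of `LefschetzCentraliser`).
* Any `ℚ`-structure on the groups; algebraic groups (the tree works with `ℂ`-points, `HodgeTheory/MotivatedGaloisGroup`).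

## References

* [Milne1999LefschetzClasses] J. S. Milne, Lefschetz classes on abelian varieties, Duke Math. J. 96 (1999)
  639–675: Notations p. 641 (isogeny = invertible in `Hom⁰`), §1 p. 643 (isogeny invariance of `C(A)`,
  independence of `α`), p. 644 (isogeny invariance of `S(A)`), §4 p. 659 (`G(A)`).
* [MumfordAV1970] D. Mumford, Abelian Varieties (1970), §19 Remark p. 169 (quasi-inverse of an isogeny),
  §1 (3) (`[n]^*` on cohomology).
* [vanGeemen1994HodgeAV] B. van Geemen, An introduction to the Hodge conjecture for abelian varieties, LNM 1594
  (1994), §3.6 (p. 236: an isogeny induces `φ^* : H¹(X, ℚ) ≅ H¹(Y, ℚ)`).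
* [HatcherAT2002] A. Hatcher, Algebraic Topology (2002), §3.2 Prop. 3.10 (naturality of the cup product).
-/

noncomputable section

open CategoryTheory
open Literature.AlgebraicTopology.SingularHomology
open Literature.AlgebraicGeometry.HodgeTheory
open Literature.AlgebraicGeometry.Motives
open Literature.AlgebraicGeometry.VanGeemen1994 (pullbackOne)

namespace Literature.AlgebraicGeometry.Milne1999

/-! ### Transport of automorphism groups along a linear equivalence -/

section LinearAlgebra

variable {R : Type*} [CommSemiring R] {M N : Type*} [AddCommMonoid M] [Module R M]
  [AddCommMonoid N] [Module R N]

/-- **Transport of structure for automorphism groups**: a linear equivalence `e : M ≃ₗ N` induces the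
group isomorphism `u ↦ e ∘ u ∘ e⁻¹ : GL(M) ≃ GL(N)` (the group-level companion of Mathlib's
`LinearEquiv.conjAlgEquiv` on `End`; Milne's "`γ ↦ V(α) ∘ γ ∘ V(α)⁻¹`", §1 p. 643).
[cite: Milne1999LefschetzClasses, §1 p. 643 (γ ↦ V(α)∘γ∘V(α)⁻¹)] -/
def autConj (e : M ≃ₗ[R] N) : (M ≃ₗ[R] M) ≃* (N ≃ₗ[R] N) where
  toFun u := (e.symm.trans u).trans e
  invFun v := (e.trans v).trans e.symm
  left_inv u := by
    ext x
    simp only [LinearEquiv.trans_apply, LinearEquiv.symm_apply_apply]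
  right_inv v := by
    ext y
    simp only [LinearEquiv.trans_apply, LinearEquiv.apply_symm_apply]
  map_mul' u v := by
    ext y
    simp only [LinearEquiv.trans_apply, LinearEquiv.mul_apply, LinearEquiv.symm_apply_apply]

/-- `autConj e u y = e (u (e⁻¹ y))`. [cite: Milne1999LefschetzClasses, §1 p. 643] -/
@[simp]
theorem autConj_apply (e : M ≃ₗ[R] N) (u : M ≃ₗ[R] M) (y : N) : autConj e u y = e (u (e.symm y)) := rfl

/-- `autConj e u (e x) = e (u x)`: the transported automorphism acts on `e x` as `u` acts on `x`.
[cite: Milne1999LefschetzClasses, §1 p. 643] -/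
theorem autConj_apply_apply (e : M ≃ₗ[R] N) (u : M ≃ₗ[R] M) (x : M) : autConj e u (e x) = e (u x) := by
  rw [autConj_apply, LinearEquiv.symm_apply_apply]

/-- The inverse transport is the transport along `e⁻¹`: `(autConj e)⁻¹ v x = e⁻¹ (v (e x))`.
[cite: Milne1999LefschetzClasses, §1 p. 643] -/
theorem autConj_symm_apply (e : M ≃ₗ[R] N) (v : N ≃ₗ[R] N) (x : M) :
    (autConj e).symm v x = e.symm (v (e x)) := rfl

/-- On underlying endomorphisms `autConj e` is Mathlib's `LinearEquiv.conjAlgEquiv`: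
`(e ∘ u ∘ e⁻¹ : N →ₗ N) = e.conjAlgEquiv u`. [cite: Milne1999LefschetzClasses, §1 p. 643] -/
theorem coe_autConj (e : M ≃ₗ[R] N) (u : M ≃ₗ[R] M) :
    ((autConj e u : N ≃ₗ[R] N) : Module.End R N) = e.conjAlgEquiv R (u : Module.End R M) :=
  LinearMap.ext fun _ ↦ rfl

end LinearAlgebra

/-! ### The isogeny `f^* : H¹(B(ℂ); ℂ) ≃ H¹(A(ℂ); ℂ)` and the quasi-inverse -/

section Isogeny

variable {A B C : AbelianVariety ℂ} {f : A ⟶ B}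

/-- **`f^*` on `H¹` as a linear equivalence**, for an isogeny `f : A ⟶ B` of complex abelian varieties
(van Geemen §3.6: "`φ^* : H¹(X, ℚ) ≅ H¹(Y, ℚ)`"; bijectivity is the tree's
`complexBetti_map_bijective_of_isIsogeny`). Milne's `V(α) : V(A) → V(B)` is its transpose.
[cite: vanGeemen1994HodgeAV, §3.6 (p. 236)] [cite: Milne1999LefschetzClasses, §1 p. 643] -/
def isogenyPullbackOne (hf : AbelianVariety.IsIsogeny f) : complexBetti B.X 1 ≃ₗ[ℂ] complexBetti A.X 1 :=
  LinearEquiv.ofBijective (complexBetti.map f.hom.hom.hom 1).hom (complexBetti_map_bijective_of_isIsogeny hf 1)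

/-- `isogenyPullbackOne hf y = f^* y`. [cite: vanGeemen1994HodgeAV, §3.6 (p. 236)] -/
@[simp]
theorem isogenyPullbackOne_apply (hf : AbelianVariety.IsIsogeny f) (y : complexBetti B.X 1) :
    isogenyPullbackOne hf y = complexBetti.map f.hom.hom.hom 1 y := rfl

/-- `(f^*)⁻¹ (f^* y) = y`. [cite: vanGeemen1994HodgeAV, §3.6 (p. 236)] -/
theorem isogenyPullbackOne_symm_map (hf : AbelianVariety.IsIsogeny f) (y : complexBetti B.X 1) :
    (isogenyPullbackOne hf).symm (complexBetti.map f.hom.hom.hom 1 y) = y := by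
  rw [← isogenyPullbackOne_apply hf, LinearEquiv.symm_apply_apply]

/-- `f^* ((f^*)⁻¹ x) = x`. [cite: vanGeemen1994HodgeAV, §3.6 (p. 236)] -/
theorem map_isogenyPullbackOne_symm (hf : AbelianVariety.IsIsogeny f) (x : complexBetti A.X 1) :
    complexBetti.map f.hom.hom.hom 1 ((isogenyPullbackOne hf).symm x) = x := by
  rw [← isogenyPullbackOne_apply hf, LinearEquiv.apply_symm_apply]

/-- **The inverse of `f^*` is `n⁻¹ g^*`** for a quasi-inverse `g` with `f ≫ g = [n]_A` (Mumford §19 Remark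
p. 169: `V(α)⁻¹ = n⁻¹ V(g)`, Milne's "inverse in `Hom⁰(B, A)`"). [cite: MumfordAV1970, §19 Remark p. 169]
[cite: Milne1999LefschetzClasses, Notations p. 641] -/
theorem isogenyPullbackOne_symm_apply (hf : AbelianVariety.IsIsogeny f) {g : B ⟶ A} {n : ℕ} (hn : n ≠ 0)
    (hfg : f ≫ g = n • 𝟙 A) (x : complexBetti A.X 1) :
    (isogenyPullbackOne hf).symm x = ((n : ℂ)⁻¹) • complexBetti.map g.hom.hom.hom 1 x := by
  apply (isogenyPullbackOne hf).injective
  rw [LinearEquiv.apply_symm_apply, map_smul, isogenyPullbackOne_apply,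
    complexBetti_map_map_of_comp_eq_nsmul_id hfg 1, pow_one, smul_smul,
    inv_mul_cancel₀ (Nat.cast_ne_zero.2 hn), one_smul]

/-- **Milne's transport `γ ↦ V(α) ∘ γ ∘ V(α)⁻¹` on `GL`, read on `H¹`**: for an isogeny `f : A ⟶ B`, the group
isomorphism `u ↦ f^* ∘ u ∘ (f^*)⁻¹ : GL(H¹(B(ℂ); ℂ)) ≃ GL(H¹(A(ℂ); ℂ))`.
[cite: Milne1999LefschetzClasses, §1 p. 643 (γ ↦ V(α)∘γ∘V(α)⁻¹)] -/
def isogenyConj (hf : AbelianVariety.IsIsogeny f) :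
    (complexBetti B.X 1 ≃ₗ[ℂ] complexBetti B.X 1) ≃* (complexBetti A.X 1 ≃ₗ[ℂ] complexBetti A.X 1) :=
  autConj (isogenyPullbackOne hf)

variable {u : complexBetti B.X 1 ≃ₗ[ℂ] complexBetti B.X 1}

/-- `isogenyConj hf u x = f^* (u ((f^*)⁻¹ x))`. [cite: Milne1999LefschetzClasses, §1 p. 643] -/
theorem isogenyConj_apply (hf : AbelianVariety.IsIsogeny f) (x : complexBetti A.X 1) :
    isogenyConj hf u x = complexBetti.map f.hom.hom.hom 1 (u ((isogenyPullbackOne hf).symm x)) := rfl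

/-- **The characteristic property**: `isogenyConj hf u (f^* y) = f^* (u y)` — the transported automorphism
does to `f^* y` what `u` does to `y`. [cite: Milne1999LefschetzClasses, §1 p. 643] -/
theorem isogenyConj_apply_map (hf : AbelianVariety.IsIsogeny f) (y : complexBetti B.X 1) :
    isogenyConj hf u (complexBetti.map f.hom.hom.hom 1 y) = complexBetti.map f.hom.hom.hom 1 (u y) := by
  rw [isogenyConj_apply, isogenyPullbackOne_symm_map]

/-- The inverse transport: `(isogenyConj hf)⁻¹ v y = (f^*)⁻¹ (v (f^* y))`. [cite: Milne1999LefschetzClasses, §1 p. 643] -/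
theorem isogenyConj_symm_apply (hf : AbelianVariety.IsIsogeny f)
    (v : complexBetti A.X 1 ≃ₗ[ℂ] complexBetti A.X 1) (y : complexBetti B.X 1) :
    (isogenyConj hf).symm v y = (isogenyPullbackOne hf).symm (v (complexBetti.map f.hom.hom.hom 1 y)) := rfl

/-- On underlying endomorphisms `isogenyConj hf` is `(f^*).conjAlgEquiv`. [cite: Milne1999LefschetzClasses, §1 p. 643] -/
theorem coe_isogenyConj (hf : AbelianVariety.IsIsogeny f) :
    ((isogenyConj hf u : complexBetti A.X 1 ≃ₗ[ℂ] complexBetti A.X 1) : Module.End ℂ (complexBetti A.X 1)) =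
      (isogenyPullbackOne hf).conjAlgEquiv ℂ (u : Module.End ℂ (complexBetti B.X 1)) :=
  coe_autConj _ _

/-! #### The two commutation rules with the quasi-inverse -/

/-- For `ψ ∈ End(A)` and a quasi-inverse `g` (`f ≫ g = [n]_A`): **`f^* ((g ≫ ψ ≫ f)^* y) = n · ψ^* (f^* y)`**
— the endomorphism `g ≫ ψ ≫ f` of `B` is `f^*`-related to `n ψ`. [cite: MumfordAV1970, §19 Remark p. 169]
[cite: Milne1999LefschetzClasses, §1 p. 643] -/
theorem map_one_map_conjHom {g : B ⟶ A} {n : ℕ} (hfg : f ≫ g = n • 𝟙 A) (ψ : A ⟶ A)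
    (y : complexBetti B.X 1) :
    complexBetti.map f.hom.hom.hom 1 (pullbackOne B (g ≫ ψ ≫ f) y) =
      (n : ℂ) • pullbackOne A ψ (complexBetti.map f.hom.hom.hom 1 y) := by
  change complexBetti.map f.hom.hom.hom 1 (complexBetti.map (g ≫ ψ ≫ f).hom.hom.hom 1 y) =
    (n : ℂ) • complexBetti.map ψ.hom.hom.hom 1 (complexBetti.map f.hom.hom.hom 1 y)
  rw [← abelianVarietyHom_map_map_apply g (ψ ≫ f) y, ← abelianVarietyHom_map_map_apply ψ f y,
    complexBetti_map_map_of_comp_eq_nsmul_id hfg 1, pow_one]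

/-- For `φ ∈ End(B)` and a quasi-inverse `g` (`g ≫ f = [n]_B`): **`(f ≫ φ ≫ g)^* (f^* y) = n · f^* (φ^* y)`**.
[cite: MumfordAV1970, §19 Remark p. 169] [cite: Milne1999LefschetzClasses, §1 p. 643] -/
theorem map_conjHom'_map_one {g : B ⟶ A} {n : ℕ} (hgf : g ≫ f = n • 𝟙 B) (φ : B ⟶ B)
    (y : complexBetti B.X 1) :
    pullbackOne A (f ≫ φ ≫ g) (complexBetti.map f.hom.hom.hom 1 y) =
      (n : ℂ) • complexBetti.map f.hom.hom.hom 1 (pullbackOne B φ y) := by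
  change complexBetti.map (f ≫ φ ≫ g).hom.hom.hom 1 (complexBetti.map f.hom.hom.hom 1 y) =
    (n : ℂ) • complexBetti.map f.hom.hom.hom 1 (complexBetti.map φ.hom.hom.hom 1 y)
  rw [← abelianVarietyHom_map_map_apply f (φ ≫ g), ← abelianVarietyHom_map_map_apply φ g,
    complexBetti_map_map_of_comp_eq_nsmul_id hgf 1, pow_one, map_smul, map_smul]

/-- `g^* (ψ^* (f^* y)) = (g ≫ ψ ≫ f)^* y`. [cite: HatcherAT2002, §3.2 Prop. 3.10] -/
theorem map_pullbackOne_map_eq (g : B ⟶ A) (ψ : A ⟶ A) (y : complexBetti B.X 1) :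
    complexBetti.map g.hom.hom.hom 1 (pullbackOne A ψ (complexBetti.map f.hom.hom.hom 1 y)) =
      pullbackOne B (g ≫ ψ ≫ f) y := by
  change complexBetti.map g.hom.hom.hom 1 (complexBetti.map ψ.hom.hom.hom 1 (complexBetti.map f.hom.hom.hom 1 y)) =
    complexBetti.map (g ≫ ψ ≫ f).hom.hom.hom 1 y
  rw [abelianVarietyHom_map_map_apply ψ f y, abelianVarietyHom_map_map_apply g (ψ ≫ f) y]

/-! ### `C(B) ⊗ ℂ ≅ C(A) ⊗ ℂ`: the centraliser algebras along an isogeny -/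

/-- **An isogeny identifies the centralisers, `⊇`**: if `T ∈ End H¹(B(ℂ); ℂ)` commutes with every `φ^*`,
`φ ∈ End(B)`, then `f^* ∘ T ∘ (f^*)⁻¹` commutes with every `ψ^*`, `ψ ∈ End(A)` — test `T` against
`φ = g ≫ ψ ≫ f` (Milne §1 p. 643 "An isogeny `α : A → B` defines an isomorphism
`γ ↦ V(α)∘γ∘V(α)⁻¹ : C(A) → C(B)`"). [cite: Milne1999LefschetzClasses, §1 p. 643] -/
theorem conjAlgEquiv_mem_centralizerAlgebra (hf : AbelianVariety.IsIsogeny f)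
    {T : Module.End ℂ (complexBetti B.X 1)} (hT : T ∈ centralizerAlgebra B) :
    (isogenyPullbackOne hf).conjAlgEquiv ℂ T ∈ centralizerAlgebra A := by
  obtain ⟨g, n, hn, hfg, -⟩ := AbelianVariety.IsIsogeny.exists_nsmul_inverse_holds hf
  have hn' : (n : ℂ) ≠ 0 := Nat.cast_ne_zero.2 hn.ne'
  rw [mem_centralizerAlgebra_iff'] at hT ⊢
  intro ψ x
  obtain ⟨y, rfl⟩ := (isogenyPullbackOne hf).surjective x
  simp only [LinearEquiv.conjAlgEquiv_apply, LinearMap.comp_apply, LinearEquiv.coe_toLinearMap,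
    LinearEquiv.symm_apply_apply]
  rw [isogenyPullbackOne_symm_apply hf hn.ne' hfg]
  simp only [isogenyPullbackOne_apply, map_smul]
  rw [map_pullbackOne_map_eq, hT (g ≫ ψ ≫ f) y, map_one_map_conjHom hfg ψ (T y), smul_smul,
    inv_mul_cancel₀ hn', one_smul]

/-- **An isogeny identifies the centralisers, `⊆`**: if `f^* ∘ T ∘ (f^*)⁻¹` commutes with every `ψ^*`,
`ψ ∈ End(A)`, then `T` commutes with every `φ^*`, `φ ∈ End(B)` — test against `ψ = f ≫ φ ≫ g` and cancel
`n` and `f^*`. [cite: Milne1999LefschetzClasses, §1 p. 643] -/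
theorem mem_centralizerAlgebra_of_conjAlgEquiv_mem (hf : AbelianVariety.IsIsogeny f)
    {T : Module.End ℂ (complexBetti B.X 1)}
    (hT : (isogenyPullbackOne hf).conjAlgEquiv ℂ T ∈ centralizerAlgebra A) : T ∈ centralizerAlgebra B := by
  obtain ⟨g, n, hn, -, hgf⟩ := AbelianVariety.IsIsogeny.exists_nsmul_inverse_holds hf
  have hn' : (n : ℂ) ≠ 0 := Nat.cast_ne_zero.2 hn.ne'
  rw [mem_centralizerAlgebra_iff'] at hT ⊢
  intro φ y
  have e := hT (f ≫ φ ≫ g) (isogenyPullbackOne hf y)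
  simp only [LinearEquiv.conjAlgEquiv_apply, LinearMap.comp_apply, LinearEquiv.coe_toLinearMap,
    LinearEquiv.symm_apply_apply] at e
  rw [isogenyPullbackOne_apply hf y, map_conjHom'_map_one hgf φ y, map_smul, isogenyPullbackOne_symm_map,
    map_smul, map_smul, isogenyPullbackOne_apply, isogenyPullbackOne_apply, map_conjHom'_map_one hgf φ (T y)] at e
  exact (complexBetti_map_bijective_of_isIsogeny hf 1).1 (smul_right_injective (complexBetti A.X 1) hn' e)

/-- **`f^* ∘ T ∘ (f^*)⁻¹ ∈ C(A) ⊗ ℂ ⟺ T ∈ C(B) ⊗ ℂ`** for an isogeny `f : A ⟶ B`.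
[cite: Milne1999LefschetzClasses, §1 p. 643] -/
theorem conjAlgEquiv_mem_centralizerAlgebra_iff (hf : AbelianVariety.IsIsogeny f)
    {T : Module.End ℂ (complexBetti B.X 1)} :
    (isogenyPullbackOne hf).conjAlgEquiv ℂ T ∈ centralizerAlgebra A ↔ T ∈ centralizerAlgebra B :=
  ⟨mem_centralizerAlgebra_of_conjAlgEquiv_mem hf, conjAlgEquiv_mem_centralizerAlgebra hf⟩

/-- **`C(B) ⊗ ℂ` is carried ONTO `C(A) ⊗ ℂ`** by `T ↦ f^* ∘ T ∘ (f^*)⁻¹` (as subalgebras of `End H¹`).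
[cite: Milne1999LefschetzClasses, §1 p. 643] -/
theorem centralizerAlgebra_map_conjAlgEquiv (hf : AbelianVariety.IsIsogeny f) :
    (centralizerAlgebra B).map
        ((isogenyPullbackOne hf).conjAlgEquiv ℂ :
          Module.End ℂ (complexBetti B.X 1) →ₐ[ℂ] Module.End ℂ (complexBetti A.X 1)) =
      centralizerAlgebra A := by
  ext S
  rw [Subalgebra.mem_map]
  constructor
  · rintro ⟨T, hT, rfl⟩
    exact conjAlgEquiv_mem_centralizerAlgebra hf hT
  · intro hS
    refine ⟨((isogenyPullbackOne hf).conjAlgEquiv ℂ).symm S, ?_, AlgEquiv.apply_symm_apply _ _⟩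
    rw [← conjAlgEquiv_mem_centralizerAlgebra_iff hf, AlgEquiv.apply_symm_apply]
    exact hS

/-- **Milne §1 p. 643: "`C(A)`, as a `k`-algebra […], depends only on the isogeny class of `A` (up to a canonical
isomorphism)"** — the `ℂ`-algebra isomorphism `C(B) ⊗ ℂ ≃ₐ C(A) ⊗ ℂ` induced by an isogeny `f : A ⟶ B`
(`T ↦ f^* ∘ T ∘ (f^*)⁻¹`). [cite: Milne1999LefschetzClasses, §1 p. 643] -/
def centralizerAlgebra.isogenyAlgEquiv (hf : AbelianVariety.IsIsogeny f) :
    centralizerAlgebra B ≃ₐ[ℂ] centralizerAlgebra A :=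
  (((isogenyPullbackOne hf).conjAlgEquiv ℂ).subalgebraMap (centralizerAlgebra B)).trans
    (Subalgebra.equivOfEq _ _ (centralizerAlgebra_map_conjAlgEquiv hf))

/-- The algebra isomorphism, evaluated: `(isogenyAlgEquiv hf T : End H¹(A)) = f^* ∘ T ∘ (f^*)⁻¹`.
[cite: Milne1999LefschetzClasses, §1 p. 643] -/
theorem centralizerAlgebra.coe_isogenyAlgEquiv (hf : AbelianVariety.IsIsogeny f) (T : centralizerAlgebra B) :
    (centralizerAlgebra.isogenyAlgEquiv hf T : Module.End ℂ (complexBetti A.X 1)) =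
      (isogenyPullbackOne hf).conjAlgEquiv ℂ (T : Module.End ℂ (complexBetti B.X 1)) := rfl

/-! ### `(C(B) ⊗ ℂ)^× ≅ (C(A) ⊗ ℂ)^×` -/

/-- **`f^* ∘ u ∘ (f^*)⁻¹ ∈ (C(A) ⊗ ℂ)^× ⟺ u ∈ (C(B) ⊗ ℂ)^×`** for an isogeny `f : A ⟶ B`.
[cite: Milne1999LefschetzClasses, §1 p. 643] -/
theorem isogenyConj_mem_centralizerGroup_iff (hf : AbelianVariety.IsIsogeny f) :
    isogenyConj hf u ∈ centralizerGroup A ↔ u ∈ centralizerGroup B := by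
  rw [mem_centralizerGroup_iff_coe_mem, mem_centralizerGroup_iff_coe_mem, coe_isogenyConj,
    conjAlgEquiv_mem_centralizerAlgebra_iff hf]

/-- `(C(B) ⊗ ℂ)^×` is carried ONTO `(C(A) ⊗ ℂ)^×` by `isogenyConj hf`. [cite: Milne1999LefschetzClasses, §1 p. 643] -/
theorem centralizerGroup_map_isogenyConj (hf : AbelianVariety.IsIsogeny f) :
    (centralizerGroup B).map (isogenyConj hf : (complexBetti B.X 1 ≃ₗ[ℂ] complexBetti B.X 1) →*
        (complexBetti A.X 1 ≃ₗ[ℂ] complexBetti A.X 1)) = centralizerGroup A := by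
  ext v
  rw [Subgroup.mem_map]
  constructor
  · rintro ⟨u, hu, rfl⟩
    exact (isogenyConj_mem_centralizerGroup_iff hf).2 hu
  · intro hv
    refine ⟨(isogenyConj hf).symm v, ?_, MulEquiv.apply_symm_apply _ _⟩
    rw [← isogenyConj_mem_centralizerGroup_iff hf, MulEquiv.apply_symm_apply]
    exact hv

/-- **Milne §1 p. 643, on the groups of units: `(C(B) ⊗ ℂ)^× ≃ (C(A) ⊗ ℂ)^×`** along an isogeny `f : A ⟶ B`
(`u ↦ f^* ∘ u ∘ (f^*)⁻¹`). [cite: Milne1999LefschetzClasses, §1 p. 643] -/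
def centralizerGroup.isogenyMulEquiv (hf : AbelianVariety.IsIsogeny f) : centralizerGroup B ≃* centralizerGroup A :=
  ((isogenyConj hf).subgroupMap (centralizerGroup B)).trans
    (MulEquiv.subgroupCongr (centralizerGroup_map_isogenyConj hf))

/-- The group isomorphism, evaluated. [cite: Milne1999LefschetzClasses, §1 p. 643] -/
theorem centralizerGroup.coe_isogenyMulEquiv (hf : AbelianVariety.IsIsogeny f) (u : centralizerGroup B) :
    (centralizerGroup.isogenyMulEquiv hf u : complexBetti A.X 1 ≃ₗ[ℂ] complexBetti A.X 1) = isogenyConj hf u :=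
  rfl

/-! ### The polarization pairing along an isogeny: `S(B)(ℂ) ≅ S(A)(ℂ)`, `G(B)(ℂ) ≅ G(A)(ℂ)` -/

/-- **Transport of the multiplier identity**, any exponent `j`: `f^* ∘ u ∘ (f^*)⁻¹` multiplies
`Q^A_{f^* h, j}` by `c` iff `u` multiplies `Q^B_{h,j}` by `c` (naturality `f^* Q_{h,j}(x, y) =
Q_{f^*h,j}(f^* x, f^* y)` and injectivity of `f^*` on `H^{2+2j}`; Milne, proof of Thm. 4.4:
"`e_D(γx, γy) = γ†γ · e_D(x, y)`"). [cite: Milne1999LefschetzClasses, §1 p. 644 and §4 p. 659]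
[cite: HatcherAT2002, §3.2 Prop. 3.10] -/
theorem forall_polarizationPairingOne_isogenyConj_iff (hf : AbelianVariety.IsIsogeny f) (h : complexBetti B.X 2)
    (j : ℕ) (c : ℂ) :
    (∀ x y : complexBetti A.X 1,
        polarizationPairingOne A.X (complexBetti.map f.hom.hom.hom 2 h) j (isogenyConj hf u x)
            (isogenyConj hf u y) =
          c • polarizationPairingOne A.X (complexBetti.map f.hom.hom.hom 2 h) j x y) ↔
      ∀ x y : complexBetti B.X 1,
        polarizationPairingOne B.X h j (u x) (u y) = c • polarizationPairingOne B.X h j x y := by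
  constructor
  · intro H x y
    apply (complexBetti_map_bijective_of_isIsogeny hf (2 + 2 * j)).1
    have e := H (complexBetti.map f.hom.hom.hom 1 x) (complexBetti.map f.hom.hom.hom 1 y)
    rw [isogenyConj_apply_map, isogenyConj_apply_map, ← map_polarizationPairingOne,
      ← map_polarizationPairingOne] at e
    rw [e, map_smul]
  · intro H x y
    obtain ⟨x, rfl⟩ := (isogenyPullbackOne hf).surjective x
    obtain ⟨y, rfl⟩ := (isogenyPullbackOne hf).surjective y
    simp only [isogenyPullbackOne_apply]
    rw [isogenyConj_apply_map, isogenyConj_apply_map, ← map_polarizationPairingOne,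
      ← map_polarizationPairingOne, H, map_smul]

/-- **`f^* ∘ u ∘ (f^*)⁻¹ ∈ S(A)(ℂ)` for `f^* h` ⟺ `u ∈ S(B)(ℂ)` for `h`** ("Clearly `S(A)` depends only on the
isogeny class of `A`", §1 p. 644), for an isogeny `f : A ⟶ B` and every class `h ∈ H²(B(ℂ); ℂ)`; uses
`dim A = dim B` (`AbelianVariety.dim_eq_of_isIsogeny`). [cite: Milne1999LefschetzClasses, §1 p. 644] -/
theorem isogenyConj_mem_unitaryCentralizerGroup_iff (hf : AbelianVariety.IsIsogeny f) (h : complexBetti B.X 2) :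
    isogenyConj hf u ∈ unitaryCentralizerGroup A (complexBetti.map f.hom.hom.hom 2 h) ↔
      u ∈ unitaryCentralizerGroup B h := by
  rw [mem_unitaryCentralizerGroup_iff, mem_unitaryCentralizerGroup_iff, isogenyConj_mem_centralizerGroup_iff hf,
    AbelianVariety.dim_eq_of_isIsogeny hf]
  refine and_congr_right fun _ ↦ ?_
  have e := forall_polarizationPairingOne_isogenyConj_iff (u := u) hf h (B.dim - 1) 1
  simp only [one_smul] at e
  exact e

/-- **`f^* ∘ u ∘ (f^*)⁻¹ ∈ G(A)(ℂ)` for `f^* h` ⟺ `u ∈ G(B)(ℂ)` for `h`**, with the same multiplier, for an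
isogeny `f : A ⟶ B` and every `h ∈ H²(B(ℂ); ℂ)` (`G(A)`, §4 p. 659, depends only on the isogeny class as
`S(A)` does). [cite: Milne1999LefschetzClasses, §1 p. 644 and §4 p. 659] -/
theorem isogenyConj_mem_similitudeCentralizerGroup_iff (hf : AbelianVariety.IsIsogeny f) (h : complexBetti B.X 2) :
    isogenyConj hf u ∈ similitudeCentralizerGroup A (complexBetti.map f.hom.hom.hom 2 h) ↔
      u ∈ similitudeCentralizerGroup B h := by
  rw [mem_similitudeCentralizerGroup_iff, mem_similitudeCentralizerGroup_iff,
    isogenyConj_mem_centralizerGroup_iff hf, AbelianVariety.dim_eq_of_isIsogeny hf]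
  exact and_congr_right fun _ ↦ exists_congr fun c ↦
    forall_polarizationPairingOne_isogenyConj_iff (u := u) hf h (B.dim - 1) (c : ℂ)

/-- `S(B)(ℂ)` (for `h`) is carried ONTO `S(A)(ℂ)` (for `f^* h`) by `isogenyConj hf`.
[cite: Milne1999LefschetzClasses, §1 p. 644] -/
theorem unitaryCentralizerGroup_map_isogenyConj (hf : AbelianVariety.IsIsogeny f) (h : complexBetti B.X 2) :
    (unitaryCentralizerGroup B h).map (isogenyConj hf : (complexBetti B.X 1 ≃ₗ[ℂ] complexBetti B.X 1) →*
        (complexBetti A.X 1 ≃ₗ[ℂ] complexBetti A.X 1)) =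
      unitaryCentralizerGroup A (complexBetti.map f.hom.hom.hom 2 h) := by
  ext v
  rw [Subgroup.mem_map]
  constructor
  · rintro ⟨u, hu, rfl⟩
    exact (isogenyConj_mem_unitaryCentralizerGroup_iff hf h).2 hu
  · intro hv
    refine ⟨(isogenyConj hf).symm v, ?_, MulEquiv.apply_symm_apply _ _⟩
    rw [← isogenyConj_mem_unitaryCentralizerGroup_iff hf h, MulEquiv.apply_symm_apply]
    exact hv

/-- `G(B)(ℂ)` (for `h`) is carried ONTO `G(A)(ℂ)` (for `f^* h`) by `isogenyConj hf`.
[cite: Milne1999LefschetzClasses, §1 p. 644 and §4 p. 659] -/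
theorem similitudeCentralizerGroup_map_isogenyConj (hf : AbelianVariety.IsIsogeny f) (h : complexBetti B.X 2) :
    (similitudeCentralizerGroup B h).map (isogenyConj hf : (complexBetti B.X 1 ≃ₗ[ℂ] complexBetti B.X 1) →*
        (complexBetti A.X 1 ≃ₗ[ℂ] complexBetti A.X 1)) =
      similitudeCentralizerGroup A (complexBetti.map f.hom.hom.hom 2 h) := by
  ext v
  rw [Subgroup.mem_map]
  constructor
  · rintro ⟨u, hu, rfl⟩
    exact (isogenyConj_mem_similitudeCentralizerGroup_iff hf h).2 hu
  · intro hv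
    refine ⟨(isogenyConj hf).symm v, ?_, MulEquiv.apply_symm_apply _ _⟩
    rw [← isogenyConj_mem_similitudeCentralizerGroup_iff hf h, MulEquiv.apply_symm_apply]
    exact hv

/-- **Milne §1 p. 644: "Clearly `S(A)` depends only on the isogeny class of `A` (up to a unique isomorphism)"**
— the group isomorphism `S(B)(ℂ) ≃ S(A)(ℂ)` induced by an isogeny `f : A ⟶ B`, for a class `h` on `B` and its
pull-back `f^* h` on `A`. [cite: Milne1999LefschetzClasses, §1 p. 644] -/
def unitaryCentralizerGroup.isogenyMulEquiv (hf : AbelianVariety.IsIsogeny f) (h : complexBetti B.X 2) :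
    unitaryCentralizerGroup B h ≃* unitaryCentralizerGroup A (complexBetti.map f.hom.hom.hom 2 h) :=
  ((isogenyConj hf).subgroupMap (unitaryCentralizerGroup B h)).trans
    (MulEquiv.subgroupCongr (unitaryCentralizerGroup_map_isogenyConj hf h))

/-- **`G(B)(ℂ) ≃ G(A)(ℂ)` along an isogeny** (Milne's `G(A)`, §4 p. 659, `≅ L(A)` by Thm. 4.4: the Lefschetz
group is an isogeny invariant). [cite: Milne1999LefschetzClasses, §1 p. 644 and §4 p. 659] -/
def similitudeCentralizerGroup.isogenyMulEquiv (hf : AbelianVariety.IsIsogeny f) (h : complexBetti B.X 2) :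
    similitudeCentralizerGroup B h ≃* similitudeCentralizerGroup A (complexBetti.map f.hom.hom.hom 2 h) :=
  ((isogenyConj hf).subgroupMap (similitudeCentralizerGroup B h)).trans
    (MulEquiv.subgroupCongr (similitudeCentralizerGroup_map_isogenyConj hf h))

/-- The isomorphism `S(B)(ℂ) ≃ S(A)(ℂ)`, evaluated. [cite: Milne1999LefschetzClasses, §1 p. 644] -/
theorem unitaryCentralizerGroup.coe_isogenyMulEquiv (hf : AbelianVariety.IsIsogeny f) (h : complexBetti B.X 2)
    (u : unitaryCentralizerGroup B h) :
    (unitaryCentralizerGroup.isogenyMulEquiv hf h u : complexBetti A.X 1 ≃ₗ[ℂ] complexBetti A.X 1) =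
      isogenyConj hf u :=
  rfl

/-- The isomorphism `G(B)(ℂ) ≃ G(A)(ℂ)`, evaluated. [cite: Milne1999LefschetzClasses, §4 p. 659] -/
theorem similitudeCentralizerGroup.coe_isogenyMulEquiv (hf : AbelianVariety.IsIsogeny f) (h : complexBetti B.X 2)
    (u : similitudeCentralizerGroup B h) :
    (similitudeCentralizerGroup.isogenyMulEquiv hf h u : complexBetti A.X 1 ≃ₗ[ℂ] complexBetti A.X 1) =
      isogenyConj hf u :=
  rfl

/-! ### "independent of the choice of `α`" and "up to a unique isomorphism" -/

/-- **Milne §1 p. 643: the isomorphism "is independent of the choice of `α`"** — two isogenies `f, f' : A ⟶ B`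
induce the SAME transport on `C(B) ⊗ ℂ`: for `T` commuting with `End(B)^*`,
`f^* ∘ T ∘ (f^*)⁻¹ = f'^* ∘ T ∘ (f'^*)⁻¹` (because `(f'^*)⁻¹ ∘ f^* = n'⁻¹ (g' ≫ f)^*` is the pull-back of an
element of `End⁰(B)`, `g'` a quasi-inverse of `f'`, with which `T` commutes).
[cite: Milne1999LefschetzClasses, §1 p. 643] -/
theorem conjAlgEquiv_eq_of_mem_centralizerAlgebra (hf : AbelianVariety.IsIsogeny f) {f' : A ⟶ B}
    (hf' : AbelianVariety.IsIsogeny f') {T : Module.End ℂ (complexBetti B.X 1)} (hT : T ∈ centralizerAlgebra B) :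
    (isogenyPullbackOne hf).conjAlgEquiv ℂ T = (isogenyPullbackOne hf').conjAlgEquiv ℂ T := by
  obtain ⟨g', n', hn', hf'g', -⟩ := AbelianVariety.IsIsogeny.exists_nsmul_inverse_holds hf'
  have hn'' : (n' : ℂ) ≠ 0 := Nat.cast_ne_zero.2 hn'.ne'
  rw [mem_centralizerAlgebra_iff'] at hT
  apply LinearMap.ext
  intro x
  obtain ⟨y, rfl⟩ := (isogenyPullbackOne hf).surjective x
  simp only [LinearEquiv.conjAlgEquiv_apply, LinearMap.comp_apply, LinearEquiv.coe_toLinearMap,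
    LinearEquiv.symm_apply_apply]
  rw [isogenyPullbackOne_symm_apply hf' hn'.ne' hf'g']
  simp only [isogenyPullbackOne_apply, map_smul]
  rw [abelianVarietyHom_map_map_apply g' f y]
  change _ = (n' : ℂ)⁻¹ • complexBetti.map f'.hom.hom.hom 1 (T (pullbackOne B (g' ≫ f) y))
  rw [hT (g' ≫ f) y]
  change _ = (n' : ℂ)⁻¹ • complexBetti.map f'.hom.hom.hom 1 (complexBetti.map (g' ≫ f).hom.hom.hom 1 (T y))
  rw [← abelianVarietyHom_map_map_apply g' f (T y), complexBetti_map_map_of_comp_eq_nsmul_id hf'g' 1, pow_one,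
    smul_smul,
    inv_mul_cancel₀ hn'', one_smul]

/-- **"independent of the choice of `α`", on `(C(B) ⊗ ℂ)^×`**: two isogenies `f, f' : A ⟶ B` transport every
`u ∈ (C(B) ⊗ ℂ)^×` (in particular every element of `S(B)(ℂ)`, `G(B)(ℂ)`) to the same automorphism of
`H¹(A(ℂ); ℂ)`. [cite: Milne1999LefschetzClasses, §1 pp. 643–644] -/
theorem isogenyConj_eq_of_mem_centralizerGroup (hf : AbelianVariety.IsIsogeny f) {f' : A ⟶ B}
    (hf' : AbelianVariety.IsIsogeny f') (hu : u ∈ centralizerGroup B) : isogenyConj hf u = isogenyConj hf' u := by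
  apply LinearEquiv.toLinearMap_injective
  rw [coe_isogenyConj, coe_isogenyConj]
  exact conjAlgEquiv_eq_of_mem_centralizerAlgebra hf hf' (mem_centralizerGroup_iff_coe_mem.1 hu)

/-- **"up to a unique isomorphism"**: transporting along `f` and then along a quasi-inverse `g`
(`g ≫ f = [n]_B`) is the identity of `GL(H¹(B(ℂ); ℂ))` — conjugation by `[n]^* = n` is trivial.
[cite: Milne1999LefschetzClasses, §1 p. 644] [cite: MumfordAV1970, §19 Remark p. 169] -/
theorem isogenyConj_isogenyConj_of_comp_eq_nsmul (hf : AbelianVariety.IsIsogeny f) {g : B ⟶ A}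
    (hg : AbelianVariety.IsIsogeny g) {n : ℕ} (hgf : g ≫ f = n • 𝟙 B)
    (u : complexBetti B.X 1 ≃ₗ[ℂ] complexBetti B.X 1) : isogenyConj hg (isogenyConj hf u) = u := by
  ext y
  obtain ⟨x, rfl⟩ := (isogenyPullbackOne hg).surjective y
  obtain ⟨y, rfl⟩ := (isogenyPullbackOne hf).surjective x
  simp only [isogenyPullbackOne_apply]
  rw [isogenyConj_apply_map, isogenyConj_apply_map, complexBetti_map_map_of_comp_eq_nsmul_id hgf 1,
    complexBetti_map_map_of_comp_eq_nsmul_id hgf 1, pow_one, map_smul]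

/-- **Functoriality**: the transport along a composite isogeny `f ≫ p` is the composite of the transports
(`(f ≫ p)^* = f^* ∘ p^*`). [cite: Milne1999LefschetzClasses, §1 p. 643] -/
theorem isogenyConj_comp (hf : AbelianVariety.IsIsogeny f) {p : B ⟶ C} (hp : AbelianVariety.IsIsogeny p)
    (w : complexBetti C.X 1 ≃ₗ[ℂ] complexBetti C.X 1) :
    isogenyConj (AbelianVariety.isIsogeny_comp hf hp) w = isogenyConj hf (isogenyConj hp w) := by
  ext x
  obtain ⟨z, rfl⟩ := (isogenyPullbackOne (AbelianVariety.isIsogeny_comp hf hp)).surjective x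
  rw [isogenyPullbackOne_apply, isogenyConj_apply_map, ← abelianVarietyHom_map_map_apply f p (w z),
    ← abelianVarietyHom_map_map_apply f p z, isogenyConj_apply_map, isogenyConj_apply_map]

/-! ### Along `IsIsogenous` -/

/-- **`C(A)` depends only on the isogeny class**: isogenous complex abelian varieties have isomorphic
`(C ⊗ ℂ)^×`. [cite: Milne1999LefschetzClasses, §1 p. 643] -/
theorem nonempty_centralizerGroup_mulEquiv_of_isIsogenous (hAB : AbelianVariety.IsIsogenous A B) :
    Nonempty (centralizerGroup A ≃* centralizerGroup B) := by
  obtain ⟨f, hf⟩ := hAB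
  exact ⟨(centralizerGroup.isogenyMulEquiv hf).symm⟩

/-- `C(A) ⊗ ℂ ≃ₐ C(B) ⊗ ℂ` for isogenous `A`, `B`. [cite: Milne1999LefschetzClasses, §1 p. 643] -/
theorem nonempty_centralizerAlgebra_algEquiv_of_isIsogenous (hAB : AbelianVariety.IsIsogenous A B) :
    Nonempty (centralizerAlgebra A ≃ₐ[ℂ] centralizerAlgebra B) := by
  obtain ⟨f, hf⟩ := hAB
  exact ⟨(centralizerAlgebra.isogenyAlgEquiv hf).symm⟩

/-- **`S(A)` depends only on the isogeny class**: for isogenous `A`, `B` and any class `h` on `B` there is a class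
`h'` on `A` (namely `f^* h`) with `S(A, h')(ℂ) ≃ S(B, h)(ℂ)`. [cite: Milne1999LefschetzClasses, §1 p. 644] -/
theorem exists_nonempty_unitaryCentralizerGroup_mulEquiv_of_isIsogenous (hAB : AbelianVariety.IsIsogenous A B)
    (h : complexBetti B.X 2) :
    ∃ h' : complexBetti A.X 2, Nonempty (unitaryCentralizerGroup A h' ≃* unitaryCentralizerGroup B h) := by
  obtain ⟨f, hf⟩ := hAB
  exact ⟨complexBetti.map f.hom.hom.hom 2 h, ⟨(unitaryCentralizerGroup.isogenyMulEquiv hf h).symm⟩⟩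

/-- **`G(A)` depends only on the isogeny class**: for isogenous `A`, `B` and any class `h` on `B`,
`G(A, f^* h)(ℂ) ≃ G(B, h)(ℂ)`. [cite: Milne1999LefschetzClasses, §1 p. 644 and §4 p. 659] -/
theorem exists_nonempty_similitudeCentralizerGroup_mulEquiv_of_isIsogenous (hAB : AbelianVariety.IsIsogenous A B)
    (h : complexBetti B.X 2) :
    ∃ h' : complexBetti A.X 2, Nonempty (similitudeCentralizerGroup A h' ≃* similitudeCentralizerGroup B h) := by
  obtain ⟨f, hf⟩ := hAB
  exact ⟨complexBetti.map f.hom.hom.hom 2 h, ⟨(similitudeCentralizerGroup.isogenyMulEquiv hf h).symm⟩⟩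

end Isogeny

end Literature.AlgebraicGeometry.Milne1999

end
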